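import Mathlib

/-!
# Stub `stub_kotzig` of line `kotzig-cutspan` (crux `SymmetryBudget.HamCompiles`,
stmt-PneNP-10637) — auxiliary file 1

Route `PneNP/SymmetryBudget`, crux `Summit.PneNP.PneNP.Theses.SymmetryBudget.HamCompiles`, line
`kotzig-cutspan`, stub `stub_kotzig` (`G.IsHamiltonian ↔ KotzigPred G F`).

Generic permutation lemmas for the combinatorial core (Kotzig's alternating closed trails, file
`…StubKotzigAux2.lean`) of the backward direction:

* `sameCycle_mul_swap_iff`, `sameCycle_mul_swap_iff_of_not_sameCycle`,
  `sameCycle_mul_swap_mul_swap_iff` — multiplying a permutation of a finite type by a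
  transposition of two points in different cycles MERGES the two cycles and leaves the other
  cycles unchanged (the splicing step of the classical proof of Euler's theorem, in permutation
  form);
* `pow_apply_ne_rev`, `not_sameCycle_rev`, `sameCycle_rev_iff` — for two fixed-point-free
  involutions `γ`, `ε`, the involution `ε` conjugates `γ * ε` to its inverse and no cycle of
  `γ * ε` is mapped to itself (a closed trail and its reverse traversal are different orbits);
* half-edges `(k, b) : ι × Bool` and their other ends `Prod.map id not (k, b) = (k, !b)`;
* three small counting / list lemmas (`countP_eq_card_fin`, `card_filter_prod_bool`,
  `forall_getLast?_head?`).
-/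

-- `Summit.PneNP.PneNP.…` duplicates `PneNP` BY DESIGN (single-problem summit, D-0017).
set_option linter.dupNamespace false

namespace Summit.PneNP.PneNP.Theorems.HamCompilesKC

namespace KotzigTrail

open Equiv Equiv.Perm Finset

/-! ### Orbits of a permutation multiplied by a transposition -/

section Merge

variable {α : Type*} [DecidableEq α]

/-- Along the orbit of `b`: the powers of `π * swap a b` at `a` follow the `π`-orbit of `b` up to
its period (when `a`, `b` lie in different cycles). -/
theorem pow_mul_swap_apply (π : Perm α) {a b : α} (hab : ¬ π.SameCycle a b) :
    ∀ k, 1 ≤ k → k ≤ Function.minimalPeriod π b → ((π * swap a b) ^ k) a = (π ^ k) b := by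
  intro k hk hkp
  induction k with
  | zero => omega
  | succ k ih =>
    rcases Nat.eq_zero_or_pos k with rfl | hpos
    · simp
    · rw [pow_succ', Perm.mul_apply, ih hpos (by omega), pow_succ', Perm.mul_apply, Perm.mul_apply]
      congr 1
      apply swap_apply_of_ne_of_ne
      · intro h
        exact hab (SameCycle.symm ⟨k, by rw [zpow_natCast, h]⟩)
      · intro h
        have hper : Function.IsPeriodicPt π k b := by
          unfold Function.IsPeriodicPt Function.IsFixedPt
          rw [iterate_eq_pow]
          exact h
        have := hper.minimalPeriod_le hpos
        omega

/-- Outside the cycles of `a` and `b`, `π * swap a b` acts like `π`. -/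
theorem pow_mul_swap_apply_of_not_sameCycle (π : Perm α) {a b z : α} (ha : ¬ π.SameCycle a z)
    (hb : ¬ π.SameCycle b z) (k : ℕ) : ((π * swap a b) ^ k) z = (π ^ k) z := by
  induction k with
  | zero => simp
  | succ k ih =>
    rw [pow_succ', Perm.mul_apply, ih, pow_succ', Perm.mul_apply, Perm.mul_apply]
    congr 1
    apply swap_apply_of_ne_of_ne
    · intro h
      exact ha (SameCycle.symm ⟨k, by rw [zpow_natCast, h]⟩)
    · intro h
      exact hb (SameCycle.symm ⟨k, by rw [zpow_natCast, h]⟩)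

variable [Fintype α]

omit [DecidableEq α] in
/-- Every point of a permutation of a finite type has positive minimal period. -/
theorem minimalPeriod_pos_perm (π : Perm α) (x : α) : 0 < Function.minimalPeriod π x :=
  Function.minimalPeriod_pos_of_mem_periodicPts (π.injective.mem_periodicPts x)

omit [DecidableEq α] in
/-- In a finite type, `SameCycle` is witnessed by a power below the minimal period. -/
theorem SameCycle.exists_lt_minimalPeriod {π : Perm α} {x y : α} (h : π.SameCycle x y) :
    ∃ k < Function.minimalPeriod π x, (π ^ k) x = y := by
  obtain ⟨k, hk⟩ := h.exists_nat_pow_eq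
  refine ⟨k % Function.minimalPeriod π x, Nat.mod_lt _ (minimalPeriod_pos_perm π x), ?_⟩
  have := Function.iterate_mod_minimalPeriod_eq (f := π) (x := x) (n := k)
  rw [iterate_eq_pow, iterate_eq_pow] at this
  rw [this, hk]

/-- **Merging lemma.** If `a` and `b` lie in different cycles of `π`, the cycle of `a` under
`π * swap a b` is the union of the two cycles. -/
theorem sameCycle_mul_swap_iff (π : Perm α) {a b : α} (hab : ¬ π.SameCycle a b) (z : α) :
    (π * swap a b).SameCycle a z ↔ π.SameCycle a z ∨ π.SameCycle b z := by
  set pa := Function.minimalPeriod π a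
  set pb := Function.minimalPeriod π b
  have hpa : 0 < pa := minimalPeriod_pos_perm π a
  have hpb : 0 < pb := minimalPeriod_pos_perm π b
  have hA := pow_mul_swap_apply π hab
  have hB : ∀ k, 1 ≤ k → k ≤ pa → ((π * swap a b) ^ k) b = (π ^ k) a := by
    have := pow_mul_swap_apply π (fun h => hab h.symm)
    rw [swap_comm] at this
    exact this
  have hpb' : ((π * swap a b) ^ pb) a = b := by
    rw [hA pb hpb le_rfl]
    have := Function.iterate_minimalPeriod (f := π) (x := b)
    rwa [iterate_eq_pow] at this
  have hpa' : ((π * swap a b) ^ pa) b = a := by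
    rw [hB pa hpa le_rfl]
    have := Function.iterate_minimalPeriod (f := π) (x := a)
    rwa [iterate_eq_pow] at this
  have hper : ((π * swap a b) ^ (pa + pb)) a = a := by
    rw [pow_add, Perm.mul_apply, hpb', hpa']
  constructor
  · intro h
    obtain ⟨k, hk⟩ := h.exists_nat_pow_eq
    have hp : Function.IsPeriodicPt (π * swap a b) (pa + pb) a := by
      unfold Function.IsPeriodicPt Function.IsFixedPt
      rw [iterate_eq_pow]
      exact hper
    have hk' : ((π * swap a b) ^ (k % (pa + pb))) a = z := by
      have := hp.iterate_mod_apply k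
      rw [iterate_eq_pow, iterate_eq_pow] at this
      rw [this, hk]
    set r := k % (pa + pb) with hr
    have hrlt : r < pa + pb := Nat.mod_lt _ (by omega)
    by_cases hr0 : r = 0
    · left
      rw [hr0, pow_zero, Perm.one_apply] at hk'
      exact hk' ▸ SameCycle.rfl
    by_cases hrb : r ≤ pb
    · right
      rw [hA r (by omega) hrb] at hk'
      exact ⟨r, by rw [zpow_natCast, hk']⟩
    · left
      obtain ⟨j, hj⟩ : ∃ j, r = j + pb := ⟨r - pb, by omega⟩
      rw [hj, pow_add, Perm.mul_apply, hpb', hB j (by omega) (by omega)] at hk'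
      exact ⟨j, by rw [zpow_natCast, hk']⟩
  · rintro (h | h)
    · obtain ⟨r, hr, hk⟩ := SameCycle.exists_lt_minimalPeriod h
      by_cases hr0 : r = 0
      · rw [hr0, pow_zero, Perm.one_apply] at hk
        exact hk ▸ SameCycle.rfl
      · have : ((π * swap a b) ^ (r + pb)) a = z := by
          rw [pow_add, Perm.mul_apply, hpb', hB r (by omega) hr.le, hk]
        exact ⟨(r + pb : ℕ), by rw [zpow_natCast, this]⟩
    · obtain ⟨r, hr, hk⟩ := SameCycle.exists_lt_minimalPeriod h
      by_cases hr0 : r = 0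
      · rw [hr0, pow_zero, Perm.one_apply] at hk
        exact ⟨pb, by rw [zpow_natCast, hpb', hk]⟩
      · exact ⟨r, by rw [zpow_natCast, hA r (by omega) hr.le, hk]⟩

/-- Outside the cycles of `a` and `b`, the cycles of `π * swap a b` are those of `π`. -/
theorem sameCycle_mul_swap_iff_of_not_sameCycle (π : Perm α) {a b z : α} (ha : ¬ π.SameCycle a z)
    (hb : ¬ π.SameCycle b z) (w : α) : (π * swap a b).SameCycle z w ↔ π.SameCycle z w := by
  constructor
  · intro h
    obtain ⟨k, hk⟩ := h.exists_nat_pow_eq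
    rw [pow_mul_swap_apply_of_not_sameCycle π ha hb] at hk
    exact ⟨k, by rw [zpow_natCast, hk]⟩
  · intro h
    obtain ⟨k, hk⟩ := h.exists_nat_pow_eq
    exact ⟨k, by rw [zpow_natCast, pow_mul_swap_apply_of_not_sameCycle π ha hb, hk]⟩

omit [Fintype α] in
/-- Two transpositions with disjoint supports commute. -/
theorem swap_mul_swap_comm_of_ne {a b c d : α} (hac : a ≠ c) (had : a ≠ d) (hbc : b ≠ c)
    (hbd : b ≠ d) : swap a b * swap c d = swap c d * swap a b := by
  apply Perm.Disjoint.commute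
  intro z
  by_cases hz : z = a ∨ z = b
  · right
    rcases hz with rfl | rfl
    · exact swap_apply_of_ne_of_ne hac had
    · exact swap_apply_of_ne_of_ne hbc hbd
  · left
    push Not at hz
    exact swap_apply_of_ne_of_ne hz.1 hz.2

/-- **Double merging.** Multiplying by two transpositions `swap a₂ b₂`, `swap a₁ b₁` with `a₂`,
`b₂` in different cycles and `a₁`, `b₁` outside these two cycles: the new cycle of a point `z₀` of
the cycle of `a₂` is the union of the old cycles of `a₂` and `b₂`. -/
theorem sameCycle_mul_swap_mul_swap_iff (π : Perm α) {a₁ b₁ a₂ b₂ z₀ : α}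
    (h₂ : ¬ π.SameCycle a₂ b₂) (ha : ¬ π.SameCycle a₂ a₁)
    (hb : ¬ π.SameCycle b₂ a₁) (ha' : ¬ π.SameCycle a₂ b₁) (hb' : ¬ π.SameCycle b₂ b₁)
    (hz : π.SameCycle z₀ a₂) (w : α) :
    (π * swap a₂ b₂ * swap a₁ b₁).SameCycle z₀ w ↔ π.SameCycle z₀ w ∨ π.SameCycle b₂ w := by
  have M1 := sameCycle_mul_swap_iff π h₂
  have M2 := fun z (hza : ¬ π.SameCycle a₂ z) (hzb : ¬ π.SameCycle b₂ z) =>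
    sameCycle_mul_swap_iff_of_not_sameCycle π hza hzb
  have step : ∀ w, (π * swap a₂ b₂).SameCycle z₀ w ↔ π.SameCycle z₀ w ∨ π.SameCycle b₂ w := by
    intro w
    have hza : (π * swap a₂ b₂).SameCycle z₀ a₂ := ((M1 z₀).2 (Or.inl hz.symm)).symm
    rw [show (π * swap a₂ b₂).SameCycle z₀ w ↔ (π * swap a₂ b₂).SameCycle a₂ w from
      ⟨fun h => hza.symm.trans h, fun h => hza.trans h⟩, M1 w]
    exact or_congr_left ⟨fun h => hz.trans h, fun h => hz.symm.trans h⟩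
  have n1 : ¬ (π * swap a₂ b₂).SameCycle a₁ z₀ := by
    rw [M2 a₁ ha hb]
    exact fun h => ha (hz.symm.trans h.symm)
  have n2 : ¬ (π * swap a₂ b₂).SameCycle b₁ z₀ := by
    rw [M2 b₁ ha' hb']
    exact fun h => ha' (h.trans hz).symm
  rw [sameCycle_mul_swap_iff_of_not_sameCycle _ n1 n2, step]

end Merge

/-! ### No orbit of `γ * ε` (two fixed-point-free involutions) is its own reverse -/

section Reverse

variable {α : Type*} {γ ε : Perm α}

/-- For fixed-point-free involutions `γ`, `ε`, no power of `γ * ε` maps `z` to `ε z`. -/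
theorem pow_apply_ne_rev (hγ : ∀ z, γ (γ z) = z) (hε : ∀ z, ε (ε z) = z) (hγfp : ∀ z, γ z ≠ z)
    (hεfp : ∀ z, ε z ≠ z) : ∀ (m : ℕ) (z : α), ((γ * ε) ^ m) z ≠ ε z := by
  intro m
  induction m using Nat.strong_induction_on with
  | _ m ih =>
    intro z h
    match m, ih, h with
    | 0, _, h => exact hεfp z (by simpa using h.symm)
    | 1, _, h => exact hγfp (ε z) (by simpa [Perm.mul_apply] using h)
    | m + 2, ih, h =>
      apply ih m (by omega) ((γ * ε) z)
      have e1 : ((γ * ε) ^ m) ((γ * ε) z) = ((γ * ε) ^ (m + 1)) z := by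
        rw [pow_succ]
        rfl
      have e2 : ε ((γ * ε) z) = ((γ * ε) ^ (m + 1)) z := by
        have h3 : (γ * ε) (ε (γ (ε z))) = ε z := by simp [Perm.mul_apply, hε, hγ]
        apply (γ * ε).injective
        rw [← Perm.mul_apply (γ * ε) ((γ * ε) ^ (m + 1)), ← pow_succ', h, ← h3]
        simp [Perm.mul_apply]
      rw [e1, e2]

/-- `ε` conjugates `γ * ε` to its inverse, hence maps cycles to cycles. -/
theorem sameCycle_rev_iff (hγ : ∀ z, γ (γ z) = z) (hε : ∀ z, ε (ε z) = z) (z w : α) :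
    (γ * ε).SameCycle (ε z) (ε w) ↔ (γ * ε).SameCycle z w := by
  have hεinv : ε⁻¹ = ε := by
    ext x
    rw [Perm.inv_def, Equiv.symm_apply_eq]
    exact (hε x).symm
  have hγinv : γ⁻¹ = γ := by
    ext x
    rw [Perm.inv_def, Equiv.symm_apply_eq]
    exact (hγ x).symm
  have hconj : ε * (γ * ε) * ε⁻¹ = (γ * ε)⁻¹ := by
    rw [mul_inv_rev, hεinv, hγinv]
    ext x
    simp [Perm.mul_apply, hε]
  have := sameCycle_conj (g := ε) (f := γ * ε) (x := ε z) (y := ε w)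
  rw [hconj, sameCycle_inv, hεinv] at this
  rw [this, hε, hε]

variable [Fintype α]

/-- No cycle of `γ * ε` contains both `z` and `ε z`. -/
theorem not_sameCycle_rev (hγ : ∀ z, γ (γ z) = z) (hε : ∀ z, ε (ε z) = z) (hγfp : ∀ z, γ z ≠ z)
    (hεfp : ∀ z, ε z ≠ z) (z : α) : ¬ (γ * ε).SameCycle z (ε z) := fun h => by
  obtain ⟨m, hm⟩ := h.exists_nat_pow_eq
  exact pow_apply_ne_rev hγ hε hγfp hεfp m z hm

end Reverse

/-! ### Half-edges -/

section HalfEdge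

/-! A half-edge of the edge `k` is a pair `(k, b) : ι × Bool`; its other end is
`Prod.map id not (k, b) = (k, !b)` (no new definition is introduced: all statements use the
Mathlib term `Prod.map id not`). -/

/-- The other end of the other end is the original half-edge. -/
@[simp] theorem flipEnd_flipEnd {ι : Type*} (h : ι × Bool) :
    Prod.map id not (Prod.map id not h) = h := by
  obtain ⟨k, b⟩ := h
  simp

/-- The other end belongs to the same edge. -/
theorem flipEnd_fst {ι : Type*} (h : ι × Bool) : (Prod.map id not h).1 = h.1 := rfl

/-- The other end is the other end. -/
theorem flipEnd_snd {ι : Type*} (h : ι × Bool) : (Prod.map id not h).2 = !h.2 := rfl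

/-- A half-edge is not its other end. -/
theorem flipEnd_ne {ι : Type*} (h : ι × Bool) : Prod.map id not h ≠ h := by
  obtain ⟨k, b⟩ := h
  simp [Prod.ext_iff]

/-- Two half-edges of the same edge are equal or opposite. -/
theorem eq_or_eq_flipEnd_of_fst_eq {ι : Type*} {h h' : ι × Bool} (e : h.1 = h'.1) :
    h = h' ∨ h = Prod.map id not h' := by
  obtain ⟨k, b⟩ := h
  obtain ⟨k', b'⟩ := h'
  simp only at e
  subst e
  cases b <;> cases b' <;> simp

/-- Taking the other end is injective. -/
theorem flipEnd_injective {ι : Type*} :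
    Function.Injective (Prod.map id not : ι × Bool → ι × Bool) :=
  fun a b h => by simpa using congrArg (Prod.map id not) h

/-- Taking the other end transports transpositions. -/
theorem flipEnd_swap {ι : Type*} [DecidableEq ι] (a b h : ι × Bool) :
    Prod.map id not (swap a b h) =
      swap (Prod.map id not a) (Prod.map id not b) (Prod.map id not h) :=
  flipEnd_injective.map_swap a b h

/-- Darts `(ιA × Bool) ⊕ (ιF × Bool)`: reversing every dart twice is the identity. -/
@[simp] theorem sumMap_flipEnd_flipEnd {ιA ιF : Type*} (z : (ιA × Bool) ⊕ (ιF × Bool)) :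
    Sum.map (Prod.map id not) (Prod.map id not)
      (Sum.map (Prod.map id not) (Prod.map id not) z) = z := by
  cases z <;> simp

/-- No dart is its own reverse. -/
theorem sumMap_flipEnd_ne {ιA ιF : Type*} (z : (ιA × Bool) ⊕ (ιF × Bool)) :
    Sum.map (Prod.map id not) (Prod.map id not) z ≠ z := by
  cases z <;> simp [flipEnd_ne]

end HalfEdge

end KotzigTrail

/-! ### Counting lemmas -/

section Count

open Finset

/-- `countP` over a list as the number of indices satisfying the predicate. -/
theorem countP_eq_card_fin {α : Type*} (p : α → Bool) (l : List α) :
    l.countP p = (univ.filter fun k : Fin l.length => p l[k]).card := by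
  induction l with
  | nil => simp
  | cons a l ih =>
    rw [List.countP_cons, ih, Finset.card_filter, Finset.card_filter]
    simp only [List.length_cons]
    rw [Fin.sum_univ_succ]
    simp only [Fin.getElem_fin, Fin.val_zero, Fin.val_succ, List.getElem_cons_zero,
      List.getElem_cons_succ]
    rw [add_comm]
    rfl

/-- Counting half-edges `ι × Bool` with a given label, end by end. -/
theorem card_filter_prod_bool {ι L : Type*} [Fintype ι] [DecidableEq L] (g : ι × Bool → L)
    (i : L) : (univ.filter fun f : ι × Bool => g f = i).card =
      (univ.filter fun k : ι => g (k, false) = i).card +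
        (univ.filter fun k : ι => g (k, true) = i).card := by
  simp only [Finset.card_filter]
  rw [Fintype.sum_prod_type]
  simp only [Fintype.sum_bool]
  rw [Finset.sum_add_distrib, add_comm]

/-- Relating `getLast?`/`head?` junction conditions to `getLast`/`head`. -/
theorem forall_getLast?_head? {V : Type*} {R : V → V → Prop} {l₁ l₂ : List V} (h₁ : l₁ ≠ [])
    (h₂ : l₂ ≠ []) (h : R (l₁.getLast h₁) (l₂.head h₂)) :
    ∀ x ∈ l₁.getLast?, ∀ y ∈ l₂.head?, R x y := by
  intro x hx y hy
  rw [List.getLast?_eq_some_getLast h₁, Option.mem_def, Option.some.injEq] at hx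
  rw [List.head?_eq_some_head h₂, Option.mem_def, Option.some.injEq] at hy
  rw [← hx, ← hy]
  exact h

end Count

/-- Registered sub-goal of `stub_kotzig` served by this file (`--supports stmt-PneNP-10637`): the
double merging lemma `KotzigTrail.sameCycle_mul_swap_mul_swap_iff`. -/
theorem stub_kotzig_merge {α : Type*} [DecidableEq α] [Fintype α] (π : Equiv.Perm α)
    {a₁ b₁ a₂ b₂ z₀ : α} (h₂ : ¬ π.SameCycle a₂ b₂) (ha : ¬ π.SameCycle a₂ a₁)
    (hb : ¬ π.SameCycle b₂ a₁) (hc : ¬ π.SameCycle a₂ b₁) (hd : ¬ π.SameCycle b₂ b₁)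
    (hz : π.SameCycle z₀ a₂) (w : α) :
    (π * Equiv.swap a₂ b₂ * Equiv.swap a₁ b₁).SameCycle z₀ w ↔
      π.SameCycle z₀ w ∨ π.SameCycle b₂ w :=
  KotzigTrail.sameCycle_mul_swap_mul_swap_iff π h₂ ha hb hc hd hz w

end Summit.PneNP.PneNP.Theorems.HamCompilesKC
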